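/-
Copyright: cell gate-hubbard-kl, typer seat t6 (D-0069 (2) B1 statement-typer wave). Proof file: discharges the named
fact `Lemma11GevreyDecay` of `FermiRG/DR2000PartI.lean`; nothing here is a claim about the Hubbard model or about
superconductivity.
-/
import Mathlib
import Literature.MathematicalPhysics.QuantumLattice.FermiRG.DR2000PartI
import HarnessLib

/-!
# Disertori–Rivasseau 2000, Part I, Appendix A, Lemma 11 — PROVED: Gevrey bounds give stretched-exponential decay

M. Disertori, V. Rivasseau, *Interacting Fermi liquid in two dimensions at finite temperature. Part I: Convergent
Attributions*, Commun. Math. Phys. **215** (2000) 251–290, arXiv:cond-mat/9907130 [DisertoriRivasseau2000], App. A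
Lemma 11, displays (A.2)–(A.3), render `paper:arxiv-cond-mat_9907130` p0016:L99–132 (LOCATOR = chunk:line of the
corpus-TeX render).  This file discharges the named fact
`Literature.MathematicalPhysics.QuantumLattice.FermiRG.DR2000.Lemma11GevreyDecay` (cell FACT-LIST F-051, DAG row
DR1.L11) of the DEFINITION-FROZEN statement file `FermiRG/DR2000PartI.lean` WITHOUT touching that file:
`theorem Lemma11GevreyDecay_holds : Lemma11GevreyDecay` — for `d`, `s ≥ 1`, `C > 0` there are `K, a > 0` such that every
smooth compactly supported `ĝ` on `ℝ^d` with `‖∂^n ĝ‖_∞ ≤ A₀ ∏_i α_i^{n_i} C^{n_i} (n_i!)^s` (all multi-indices `n`) has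
`|∫ e^{−ipx} ĝ(p) dp| ≤ K A₀ |supp ĝ| e^{−a Σ_i |x_i/α_i|^{1/s}}`.

THE PRINTED PROOF (p0016:L116–132) and this file.  Print: (i) integrate by parts, `f(x) = ∏_i (ix_i)^{−n_i}
∫ e^{−ipx} ĝ^{(n)}(p) dp`, so `|f(x)| ≤ ‖ĝ^{(n)}‖_∞ V_f / ∏|x_i|^{n_i}`; (ii) optimise each `n_i` (Stirling).  We follow
exactly this: §1 is the algebra of the statement file's `partialPow`/`mixedPartial` (`∂_i^{m+1} = ∂_i^m ∂_i`, `∂_i` is the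
Fréchet derivative on `e_i`, hence smooth and compactly supported); §2 is step (i), one coordinate at a time (Fubini
through `MeasurableEquiv.piFinSuccAbove`, one-variable integration by parts on the line); §3 supplies the one point the
print glosses over — `V_f` is the volume of the SUPPORT of `ĝ`, so one needs `∂^n ĝ = 0` a.e. on `{ĝ = 0}`: on every
coordinate line the zeros of a `C¹` function with non-zero derivative are isolated, hence countable (Cantor–Bendixson),
hence null, and Fubini; §4 is step (ii) with the explicit choice `n = ⌊(y/C)^{1/s}/2⌋` (`n! ≤ n^n` replaces Stirling),
giving `K = 2^{sd}`, `a = s log 2/(2C^{1/s})`.  No definitions; all helpers are `private`.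
-/

noncomputable section

open MeasureTheory Set Filter Function
open scoped Topology BigOperators

namespace Literature.MathematicalPhysics.QuantumLattice.FermiRG.DR2000

/-! ## 1. The coordinate derivatives `partialPow` / `mixedPartial` of the statement file -/

/-- `∂_i^0 h = h`. [cite: DisertoriRivasseau2000, App. A (A.2) p0016:L102–105] -/
private theorem partialPow_zero {d : ℕ} (i : Fin d) (h : (Fin d → ℝ) → ℂ) : partialPow i 0 h = h := by
  funext p
  simp [partialPow]

/-- `∂_i^{m+1} h = ∂_i^m (∂_i h)` (purely formal). [cite: DisertoriRivasseau2000, App. A (A.2) p0016:L102–105] -/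
private theorem partialPow_succ' {d : ℕ} (i : Fin d) (m : ℕ) (h : (Fin d → ℝ) → ℂ) :
    partialPow i (m + 1) h = partialPow i m (partialPow i 1 h) := by
  funext p
  simp only [partialPow, iteratedDeriv_succ', iteratedDeriv_zero, Function.update_idem, Function.update_self]

/-- `∂_i h (p) = Dh(p)·e_i` for differentiable `h`. [cite: DisertoriRivasseau2000, App. A (A.2) p0016:L102–105] -/
private theorem partialPow_one_eq {d : ℕ} (i : Fin d) {h : (Fin d → ℝ) → ℂ} (hh : Differentiable ℝ h)
    (p : Fin d → ℝ) : partialPow i 1 h p = fderiv ℝ h p (Pi.single i 1) := by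
  simp only [partialPow, iteratedDeriv_one]
  have h2 : HasFDerivAt h (fderiv ℝ h (Function.update p i (p i))) (Function.update p i (p i)) :=
    (hh _).hasFDerivAt
  have h3 := h2.comp_hasDerivAt (p i) (hasDerivAt_update p i (p i))
  rw [Function.update_eq_self] at h3
  exact h3.deriv

/-- `∂_i h` along the `i`-th coordinate line through `insertNth i t q` is the derivative of the section.
[cite: DisertoriRivasseau2000, App. A (A.2) p0016:L102–105] -/
private theorem hasDerivAt_comp_insertNth {d : ℕ} (i : Fin (d + 1)) {h : (Fin (d + 1) → ℝ) → ℂ}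
    (hh : Differentiable ℝ h) (q : Fin d → ℝ) (t : ℝ) :
    HasDerivAt (fun t => h (Fin.insertNth i t q)) (partialPow i 1 h (Fin.insertNth i t q)) t := by
  rw [partialPow_one_eq i hh]
  have h1 : (fun t' => h (Fin.insertNth i t' q)) = fun t' => h (Function.update (Fin.insertNth i t q) i t') := by
    funext t'; rw [Fin.update_insertNth]
  rw [h1]
  have h2 : HasFDerivAt h (fderiv ℝ h (Function.update (Fin.insertNth i t q) i t))
      (Function.update (Fin.insertNth i t q) i t) := (hh _).hasFDerivAt
  have h3 := h2.comp_hasDerivAt t (hasDerivAt_update (Fin.insertNth i t q) i t)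
  rw [Fin.update_insertNth] at h3
  exact h3

/-- `∂_i` preserves smoothness. [cite: DisertoriRivasseau2000, App. A (A.2) p0016:L102–105] -/
private theorem partialPow_one_contDiff {d : ℕ} (i : Fin d) {h : (Fin d → ℝ) → ℂ}
    (hh : ContDiff ℝ ((⊤ : ℕ∞) : WithTop ℕ∞) h) : ContDiff ℝ ((⊤ : ℕ∞) : WithTop ℕ∞) (partialPow i 1 h) := by
  have hd : Differentiable ℝ h := (contDiff_infty_iff_fderiv.1 hh).1
  have : partialPow i 1 h = fun p => fderiv ℝ h p (Pi.single i 1) := funext (partialPow_one_eq i hd)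
  rw [this]
  exact (contDiff_infty_iff_fderiv.1 hh).2.clm_apply contDiff_const

/-- `∂_i` preserves compact support. [cite: DisertoriRivasseau2000, App. A (A.2) p0016:L102–105] -/
private theorem partialPow_one_hasCompactSupport {d : ℕ} (i : Fin d) {h : (Fin d → ℝ) → ℂ}
    (hh : ContDiff ℝ ((⊤ : ℕ∞) : WithTop ℕ∞) h) (hc : HasCompactSupport h) :
    HasCompactSupport (partialPow i 1 h) := by
  have hd : Differentiable ℝ h := (contDiff_infty_iff_fderiv.1 hh).1
  have : partialPow i 1 h = fun p => fderiv ℝ h p (Pi.single i 1) := funext (partialPow_one_eq i hd)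
  rw [this]
  refine (hc.fderiv (𝕜 := ℝ)).mono fun p hp => ?_
  rw [mem_support] at hp ⊢
  intro h0
  exact hp (by rw [h0]; rfl)

/-- `∂_i^m` preserves smoothness and compact support. [cite: DisertoriRivasseau2000, App. A (A.2) p0016:L102–105] -/
private theorem partialPow_smooth {d : ℕ} (i : Fin d) (m : ℕ) {h : (Fin d → ℝ) → ℂ}
    (hh : ContDiff ℝ ((⊤ : ℕ∞) : WithTop ℕ∞) h) (hc : HasCompactSupport h) :
    ContDiff ℝ ((⊤ : ℕ∞) : WithTop ℕ∞) (partialPow i m h) ∧ HasCompactSupport (partialPow i m h) := by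
  induction m generalizing h with
  | zero => rw [partialPow_zero]; exact ⟨hh, hc⟩
  | succ m ih =>
    rw [partialPow_succ']
    exact ih (partialPow_one_contDiff i hh) (partialPow_one_hasCompactSupport i hh hc)

/-- The iterated coordinate derivatives along a list of coordinates preserve smoothness and compact support.
[cite: DisertoriRivasseau2000, App. A (A.2) p0016:L102–105] -/
private theorem foldr_smooth {d : ℕ} (n : Fin d → ℕ) (L : List (Fin d)) {g : (Fin d → ℝ) → ℂ}
    (hg : ContDiff ℝ ((⊤ : ℕ∞) : WithTop ℕ∞) g) (hc : HasCompactSupport g) :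
    ContDiff ℝ ((⊤ : ℕ∞) : WithTop ℕ∞) (L.foldr (fun i h => partialPow i (n i) h) g) ∧
      HasCompactSupport (L.foldr (fun i h => partialPow i (n i) h) g) := by
  induction L with
  | nil => exact ⟨hg, hc⟩
  | cons i L ih =>
    rw [List.foldr_cons]
    exact partialPow_smooth i (n i) ih.1 ih.2

/-- A compactly supported function restricted to a coordinate line has compact support.
[cite: DisertoriRivasseau2000, App. A p0016:L120–126] -/
private theorem hasCompactSupport_comp_insertNth {d : ℕ} (i : Fin (d + 1)) {f : (Fin (d + 1) → ℝ) → ℂ}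
    (hf : HasCompactSupport f) (q : Fin d → ℝ) : HasCompactSupport fun t : ℝ => f (Fin.insertNth i t q) := by
  refine HasCompactSupport.intro ((hf.isCompact).image (continuous_apply i)) fun t ht => ?_
  by_contra hne
  refine ht ⟨Fin.insertNth i t q, subset_tsupport _ (mem_support.2 hne), ?_⟩
  simp

/-- A compactly supported function on the line tends to `0` at `±∞`. [cite: DisertoriRivasseau2000, App. A p0016:L120–126] -/
private theorem tendsto_zero_of_hasCompactSupport {f : ℝ → ℂ} (hf : HasCompactSupport f) :
    Tendsto f atBot (𝓝 0) ∧ Tendsto f atTop (𝓝 0) := by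
  obtain ⟨R, hR⟩ := hf.isCompact.isBounded.subset_closedBall 0
  have hz : ∀ t, R < |t| → f t = 0 := fun t ht =>
    image_eq_zero_of_notMem_tsupport fun h => by
      have := hR h
      rw [Metric.mem_closedBall, dist_zero_right, Real.norm_eq_abs] at this
      linarith
  constructor
  · refine tendsto_const_nhds.congr' ?_
    filter_upwards [eventually_lt_atBot (-|R|)] with t ht
    exact (hz t (by cases abs_cases t <;> cases abs_cases R <;> linarith)).symm
  · refine tendsto_const_nhds.congr' ?_
    filter_upwards [eventually_gt_atTop |R|] with t ht
    exact (hz t (by cases abs_cases t <;> cases abs_cases R <;> linarith)).symm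

/-! ## 2. Step (i) of the printed proof: integration by parts, one coordinate at a time -/

/-- `piFinSuccAbove` is `insertNth` backwards. [cite: DisertoriRivasseau2000, App. A p0016:L120–122] -/
private theorem piFinSuccAbove_symm_pair {d : ℕ} (i : Fin (d + 1)) (t : ℝ) (q : Fin d → ℝ) :
    (MeasurableEquiv.piFinSuccAbove (fun _ : Fin (d + 1) => ℝ) i).symm (t, q) = Fin.insertNth i t q := rfl

/-- The phase splits along the coordinate `i`: `Σ_j p_j x_j = t x_i + Σ_k q_k x_{i.succAbove k}` for `p = insertNth i t q`.
[cite: DisertoriRivasseau2000, App. A p0016:L120–122] -/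
private theorem sum_insertNth_mul {d : ℕ} (i : Fin (d + 1)) (t : ℝ) (q : Fin d → ℝ) (x : Fin (d + 1) → ℝ) :
    ∑ j, (Fin.insertNth i t q : Fin (d + 1) → ℝ) j * x j = t * x i + ∑ k, q k * x (i.succAbove k) := by
  rw [Fin.sum_univ_succAbove _ i]
  simp [Fin.insertNth_apply_same, Fin.insertNth_apply_succAbove]

/-- One-variable integration by parts against the phase: `∫ e^{−itξ} ψ'(t) dt = (iξ) ∫ e^{−itξ} ψ(t) dt` for smooth
compactly supported `ψ`. [cite: DisertoriRivasseau2000, App. A p0016:L120–122] -/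
private theorem integral_phase_mul_deriv {ψ ψ' : ℝ → ℂ} (hψ : ∀ t, HasDerivAt ψ (ψ' t) t) (hc : HasCompactSupport ψ)
    (hc' : HasCompactSupport ψ') (hcont : Continuous ψ) (hcont' : Continuous ψ') (ξ : ℝ) :
    ∫ t : ℝ, Complex.exp (-((t * ξ : ℝ) : ℂ) * Complex.I) * ψ' t =
      (Complex.I * ξ) * ∫ t : ℝ, Complex.exp (-((t * ξ : ℝ) : ℂ) * Complex.I) * ψ t := by
  set u : ℝ → ℂ := fun t => Complex.exp (-((t * ξ : ℝ) : ℂ) * Complex.I) with hu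
  set u' : ℝ → ℂ := fun t => Complex.exp (-((t * ξ : ℝ) : ℂ) * Complex.I) * (-((1 : ℝ) : ℂ) * ξ * Complex.I)
    with hu'
  have hud : ∀ t, HasDerivAt u (u' t) t := by
    intro t
    have h1 : HasDerivAt (fun t : ℝ => -(((t * ξ : ℝ) : ℂ)) * Complex.I) (-((1 : ℝ) : ℂ) * ξ * Complex.I) t := by
      have := (((hasDerivAt_id t).mul_const ξ).ofReal_comp).neg.mul_const Complex.I
      simpa using this
    simpa [hu, hu'] using h1.cexp
  have hucont : Continuous u := by simp only [hu]; fun_prop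
  have hu'cont : Continuous u' := by simp only [hu']; fun_prop
  have hlim := tendsto_zero_of_hasCompactSupport (hc.mul_left (f := u))
  have hibp := integral_mul_deriv_eq_deriv_mul (u := u) (v := ψ) (u' := u') (v' := ψ')
    (fun t _ => hud t) (fun t _ => hψ t)
    ((hucont.mul hcont').integrable_of_hasCompactSupport (hc'.mul_left))
    ((hu'cont.mul hcont).integrable_of_hasCompactSupport (hc.mul_left)) hlim.1 hlim.2
  simp only [hu, hu'] at hibp
  rw [hibp, sub_self, zero_sub, ← integral_neg, ← integral_const_mul]
  congr 1
  funext t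
  push_cast
  ring

/-- Step (i), one derivative in one coordinate: `∫ e^{−ipx} ∂_i h(p) dp = (i x_i) ∫ e^{−ipx} h(p) dp` for smooth
compactly supported `h` on `ℝ^{d+1}`. [cite: DisertoriRivasseau2000, App. A p0016:L120–122] -/
private theorem integral_partialPow_one {d : ℕ} (i : Fin (d + 1)) {h : (Fin (d + 1) → ℝ) → ℂ}
    (hh : ContDiff ℝ ((⊤ : ℕ∞) : WithTop ℕ∞) h) (hc : HasCompactSupport h) (x : Fin (d + 1) → ℝ) :
    ∫ p, Complex.exp (-((∑ j, p j * x j : ℝ) : ℂ) * Complex.I) * partialPow i 1 h p =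
      (Complex.I * x i) * ∫ p, Complex.exp (-((∑ j, p j * x j : ℝ) : ℂ) * Complex.I) * h p := by
  have hd : Differentiable ℝ h := (contDiff_infty_iff_fderiv.1 hh).1
  have hDsmooth := partialPow_one_contDiff i hh
  have hDc := partialPow_one_hasCompactSupport i hh hc
  have hvp := (volume_preserving_piFinSuccAbove (fun _ : Fin (d + 1) => ℝ) i).symm
  -- transport both integrals to `ℝ × ℝ^d`
  have hphase : Continuous fun p : Fin (d + 1) → ℝ => Complex.exp (-((∑ j, p j * x j : ℝ) : ℂ) * Complex.I) := by
    fun_prop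
  have hT : ∀ F : (Fin (d + 1) → ℝ) → ℂ, Continuous F → HasCompactSupport F →
      ∫ p, Complex.exp (-((∑ j, p j * x j : ℝ) : ℂ) * Complex.I) * F p =
        ∫ q : Fin d → ℝ, ∫ t : ℝ, Complex.exp (-((t * x i : ℝ) : ℂ) * Complex.I) *
          (Complex.exp (-((∑ k, q k * x (i.succAbove k) : ℝ) : ℂ) * Complex.I) * F (Fin.insertNth i t q)) := by
    intro F hF hFc
    have hint : Integrable fun p : Fin (d + 1) → ℝ => Complex.exp (-((∑ j, p j * x j : ℝ) : ℂ) * Complex.I) * F p :=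
      (hphase.mul hF).integrable_of_hasCompactSupport hFc.mul_left
    rw [← hvp.integral_comp', Measure.volume_eq_prod, integral_prod_symm]
    · congr 1
      funext q
      congr 1
      funext t
      simp only [piFinSuccAbove_symm_pair, sum_insertNth_mul]
      push_cast
      rw [neg_add, add_mul, Complex.exp_add]
      ring
    · rw [← Measure.volume_eq_prod]
      exact (hvp.integrable_comp_emb (MeasurableEquiv.measurableEmbedding _)).2 hint
  rw [hT _ hDsmooth.continuous hDc, hT _ hh.continuous hc, ← integral_const_mul]
  congr 1
  funext q
  -- the inner integral: integration by parts on the line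
  have hψ := hasDerivAt_comp_insertNth i hd q
  have h1 := integral_phase_mul_deriv hψ (hasCompactSupport_comp_insertNth i hc q)
    (hasCompactSupport_comp_insertNth i hDc q) (hh.continuous.comp (by fun_prop))
    (hDsmooth.continuous.comp (by fun_prop)) (x i)
  set cq : ℂ := Complex.exp (-((∑ k, q k * x (i.succAbove k) : ℝ) : ℂ) * Complex.I) with hcq
  have e1 : (fun t : ℝ => Complex.exp (-((t * x i : ℝ) : ℂ) * Complex.I) * (cq * partialPow i 1 h (Fin.insertNth i t q)))
      = fun t => cq * (Complex.exp (-((t * x i : ℝ) : ℂ) * Complex.I) * partialPow i 1 h (Fin.insertNth i t q)) := by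
    funext t; ring
  have e2 : (fun t : ℝ => Complex.exp (-((t * x i : ℝ) : ℂ) * Complex.I) * (cq * h (Fin.insertNth i t q)))
      = fun t => cq * (Complex.exp (-((t * x i : ℝ) : ℂ) * Complex.I) * h (Fin.insertNth i t q)) := by
    funext t; ring
  rw [e1, e2, integral_const_mul, integral_const_mul, h1]
  ring

/-- Step (i), `m` derivatives in one coordinate. [cite: DisertoriRivasseau2000, App. A p0016:L120–122] -/
private theorem integral_partialPow {d : ℕ} (i : Fin d) (m : ℕ) {h : (Fin d → ℝ) → ℂ}
    (hh : ContDiff ℝ ((⊤ : ℕ∞) : WithTop ℕ∞) h) (hc : HasCompactSupport h) (x : Fin d → ℝ) :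
    ∫ p, Complex.exp (-((∑ j, p j * x j : ℝ) : ℂ) * Complex.I) * partialPow i m h p =
      (Complex.I * x i) ^ m * ∫ p, Complex.exp (-((∑ j, p j * x j : ℝ) : ℂ) * Complex.I) * h p := by
  cases d with
  | zero => exact i.elim0
  | succ d =>
    induction m generalizing h with
    | zero => rw [partialPow_zero, pow_zero, one_mul]
    | succ m ih =>
      rw [partialPow_succ', ih (partialPow_one_contDiff i hh) (partialPow_one_hasCompactSupport i hh hc),
        integral_partialPow_one i hh hc, pow_succ]
      ring

/-- Step (i) for a list of coordinates. [cite: DisertoriRivasseau2000, App. A p0016:L120–122] -/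
private theorem integral_foldr {d : ℕ} (n : Fin d → ℕ) (L : List (Fin d)) {g : (Fin d → ℝ) → ℂ}
    (hg : ContDiff ℝ ((⊤ : ℕ∞) : WithTop ℕ∞) g) (hc : HasCompactSupport g) (x : Fin d → ℝ) :
    ∫ p, Complex.exp (-((∑ j, p j * x j : ℝ) : ℂ) * Complex.I) * (L.foldr (fun i h => partialPow i (n i) h) g) p =
      (L.map fun i => (Complex.I * x i) ^ (n i)).prod *
        ∫ p, Complex.exp (-((∑ j, p j * x j : ℝ) : ℂ) * Complex.I) * g p := by
  induction L with
  | nil => simp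
  | cons i L ih =>
    rw [List.foldr_cons, integral_partialPow i (n i) (foldr_smooth n L hg hc).1 (foldr_smooth n L hg hc).2, ih,
      List.map_cons, List.prod_cons, mul_assoc]

/-- **Step (i) of the printed proof**: `∫ e^{−ipx} ∂^n ĝ(p) dp = ∏_i (ix_i)^{n_i} ∫ e^{−ipx} ĝ(p) dp`.
[cite: DisertoriRivasseau2000, App. A p0016:L120–122] -/
private theorem integral_mixedPartial {d : ℕ} (n : Fin d → ℕ) {g : (Fin d → ℝ) → ℂ}
    (hg : ContDiff ℝ ((⊤ : ℕ∞) : WithTop ℕ∞) g) (hc : HasCompactSupport g) (x : Fin d → ℝ) :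
    ∫ p, Complex.exp (-((∑ j, p j * x j : ℝ) : ℂ) * Complex.I) * mixedPartial n g p =
      (∏ i, (Complex.I * x i) ^ (n i)) * ∫ p, Complex.exp (-((∑ j, p j * x j : ℝ) : ℂ) * Complex.I) * g p := by
  rw [mixedPartial, integral_foldr n _ hg hc, Fin.prod_univ_def]

/-! ## 3. The volume factor is the volume of the SUPPORT: `∂^n ĝ = 0` a.e. on `{ĝ = 0}` -/

/-- On the line, the zeros of a differentiable function at which the derivative does not vanish form a countable set
(they are isolated; Cantor–Bendixson). [cite: DisertoriRivasseau2000, App. A p0016:L122–126] -/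
private theorem countable_simpleZeros {ψ : ℝ → ℂ} (hψ : Differentiable ℝ ψ) :
    {t : ℝ | ψ t = 0 ∧ deriv ψ t ≠ 0}.Countable := by
  obtain ⟨V, D, hV, hD, hZ⟩ := exists_countable_union_perfect_of_isClosed
    (isClosed_singleton.preimage hψ.continuous : IsClosed (ψ ⁻¹' {0}))
  refine hV.mono fun t ht => ?_
  have htZ : t ∈ ψ ⁻¹' {0} := ht.1
  rw [hZ] at htZ
  rcases htZ with htV | htD
  · exact htV
  · exfalso
    have h1 : ∀ᶠ z in 𝓝[≠] t, ψ z ≠ 0 := (hψ t).hasDerivAt.eventually_ne ht.2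
    rw [eventually_nhdsWithin_iff] at h1
    have h2 : ∃ᶠ y in 𝓝 t, y ≠ t ∧ y ∈ D := accPt_iff_frequently.1 (hD.acc t htD)
    obtain ⟨y, ⟨hyt, hyD⟩, hy⟩ := (h2.and_eventually h1).exists
    have : y ∈ ψ ⁻¹' {0} := by rw [hZ]; exact Or.inr hyD
    exact hy (mem_compl_singleton_iff.2 hyt) this

/-- `∂_i h = 0` almost everywhere on `{h = 0}` (Fubini over the coordinate lines).
[cite: DisertoriRivasseau2000, App. A p0016:L122–126] -/
private theorem ae_partialPow_one_eq_zero {d : ℕ} (i : Fin (d + 1)) {h : (Fin (d + 1) → ℝ) → ℂ}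
    (hh : ContDiff ℝ ((⊤ : ℕ∞) : WithTop ℕ∞) h) :
    ∀ᵐ p : Fin (d + 1) → ℝ, h p = 0 → partialPow i 1 h p = 0 := by
  have hd : Differentiable ℝ h := (contDiff_infty_iff_fderiv.1 hh).1
  have hDcont : Continuous (partialPow i 1 h) := (partialPow_one_contDiff i hh).continuous
  set B : Set (Fin (d + 1) → ℝ) := {p | h p = 0 ∧ partialPow i 1 h p ≠ 0} with hB
  have hBm : MeasurableSet B :=
    (isClosed_eq hh.continuous continuous_const).measurableSet.inter
      (isOpen_ne_fun hDcont continuous_const).measurableSet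
  have hB0 : volume B = 0 := by
    have hvp := (volume_preserving_piFinSuccAbove (fun _ : Fin (d + 1) => ℝ) i).symm
    rw [← hvp.measure_preimage hBm.nullMeasurableSet, Measure.volume_eq_prod,
      Measure.prod_apply_symm (hBm.preimage (MeasurableEquiv.measurable _))]
    refine (lintegral_congr fun q => ?_).trans lintegral_zero
    -- the section at `q` is the set of simple zeros of the section `t ↦ h (insertNth i t q)`
    have hsub : (fun t : ℝ => (t, q)) ⁻¹'
        ((MeasurableEquiv.piFinSuccAbove (fun _ : Fin (d + 1) => ℝ) i).symm ⁻¹' B) ⊆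
        {t : ℝ | (fun t => h (Fin.insertNth i t q)) t = 0 ∧ deriv (fun t => h (Fin.insertNth i t q)) t ≠ 0} := by
      intro t ht
      simp only [mem_preimage, piFinSuccAbove_symm_pair, hB, mem_setOf_eq] at ht
      refine ⟨ht.1, ?_⟩
      rw [(hasDerivAt_comp_insertNth i hd q t).deriv]
      exact ht.2
    exact measure_mono_null hsub
      ((countable_simpleZeros (fun t => (hasDerivAt_comp_insertNth i hd q t).differentiableAt)).measure_zero _)
  rw [ae_iff]
  refine measure_mono_null (fun p hp => ?_) hB0
  simp only [Classical.not_imp, mem_setOf_eq] at hp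
  exact hp

/-- `∂_i^m h = 0` a.e. on `{ĝ = 0}` whenever `h = 0` a.e. there. [cite: DisertoriRivasseau2000, App. A p0016:L122–126] -/
private theorem ae_partialPow_eq_zero {d : ℕ} (i : Fin d) (m : ℕ) {g h : (Fin d → ℝ) → ℂ}
    (hh : ContDiff ℝ ((⊤ : ℕ∞) : WithTop ℕ∞) h) (hz : ∀ᵐ p, g p = 0 → h p = 0) :
    ∀ᵐ p, g p = 0 → partialPow i m h p = 0 := by
  cases d with
  | zero => exact i.elim0
  | succ d =>
    induction m generalizing h with
    | zero => rw [partialPow_zero]; exact hz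
    | succ m ih =>
      rw [partialPow_succ']
      refine ih (partialPow_one_contDiff i hh) ?_
      filter_upwards [hz, ae_partialPow_one_eq_zero i hh] with p h1 h2 hg
      exact h2 (h1 hg)

/-- `∂^n ĝ = 0` a.e. on `{ĝ = 0}` (list form). [cite: DisertoriRivasseau2000, App. A p0016:L122–126] -/
private theorem ae_foldr_eq_zero {d : ℕ} (n : Fin d → ℕ) (L : List (Fin d)) {g : (Fin d → ℝ) → ℂ}
    (hg : ContDiff ℝ ((⊤ : ℕ∞) : WithTop ℕ∞) g) (hc : HasCompactSupport g) :
    ∀ᵐ p, g p = 0 → (L.foldr (fun i h => partialPow i (n i) h) g) p = 0 := by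
  induction L with
  | nil => exact Eventually.of_forall fun p hp => hp
  | cons i L ih =>
    rw [List.foldr_cons]
    exact ae_partialPow_eq_zero i (n i) (foldr_smooth n L hg hc).1 ih

/-- **The `V_f` factor**: `|∫ e^{−ipx} ∂^n ĝ| ≤ ‖∂^n ĝ‖_∞ · |supp ĝ|`. [cite: DisertoriRivasseau2000, App. A p0016:L122–126] -/
private theorem norm_integral_mixedPartial_le {d : ℕ} (n : Fin d → ℕ) {g : (Fin d → ℝ) → ℂ}
    (hg : ContDiff ℝ ((⊤ : ℕ∞) : WithTop ℕ∞) g) (hc : HasCompactSupport g) {B : ℝ}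
    (hB : ∀ p, ‖mixedPartial n g p‖ ≤ B) (x : Fin d → ℝ) :
    ‖∫ p, Complex.exp (-((∑ j, p j * x j : ℝ) : ℂ) * Complex.I) * mixedPartial n g p‖ ≤
      B * (volume (Function.support g)).toReal := by
  have hae : ∀ᵐ p : Fin d → ℝ, p ∉ Function.support g →
      Complex.exp (-((∑ j, p j * x j : ℝ) : ℂ) * Complex.I) * mixedPartial n g p = 0 := by
    filter_upwards [ae_foldr_eq_zero n (List.finRange d) hg hc] with p hp hps
    rw [notMem_support] at hps
    rw [mixedPartial, hp hps, mul_zero]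
  rw [← setIntegral_eq_integral_of_ae_compl_eq_zero hae]
  have hfin : volume (Function.support g) < ⊤ :=
    (measure_mono (subset_tsupport g)).trans_lt hc.isCompact.measure_lt_top
  refine (norm_setIntegral_le_of_norm_le_const hfin fun p _ => ?_).trans (le_of_eq (by rw [measureReal_def]))
  rw [norm_mul, ← Complex.ofReal_neg, Complex.norm_exp_ofReal_mul_I, one_mul]
  exact hB p

/-! ## 4. Step (ii) of the printed proof: optimisation in the order of the derivatives -/

/-- With `n = ⌊(y/C)^{1/s}/2⌋`: `(C/y)^n (n!)^s ≤ 2^s e^{−a y^{1/s}}`, `a = s log 2/(2C^{1/s})` (`n! ≤ n^n` in place of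
Stirling). [cite: DisertoriRivasseau2000, App. A p0016:L127–132] -/
private theorem gevrey_opt {s C y : ℝ} (hs : 1 ≤ s) (hC : 0 < C) (hy : 0 < y) :
    ∃ n : ℕ, (C / y) ^ n * ((Nat.factorial n : ℕ) : ℝ) ^ s ≤
      (2 : ℝ) ^ s * Real.exp (-(s * Real.log 2 / (2 * C ^ (1 / s))) * y ^ (1 / s)) := by
  have hs0 : 0 < s := by linarith
  set u : ℝ := (y / C) ^ (1 / s) / 2 with hu
  have hu0 : 0 ≤ u := by positivity
  refine ⟨⌊u⌋₊, ?_⟩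
  set n : ℕ := ⌊u⌋₊ with hn
  have hnu : (n : ℝ) ≤ u := Nat.floor_le hu0
  have hun : u < n + 1 := Nat.lt_floor_add_one u
  have hus : u ^ s = y / C / 2 ^ s := by
    rw [hu, Real.div_rpow (by positivity) (by norm_num), ← Real.rpow_mul (by positivity),
      one_div_mul_cancel hs0.ne', Real.rpow_one]
  have hfact : ((Nat.factorial n : ℕ) : ℝ) ^ s ≤ (y / C / 2 ^ s) ^ n := by
    have h1 : ((Nat.factorial n : ℕ) : ℝ) ≤ (n : ℝ) ^ n := by exact_mod_cast Nat.factorial_le_pow n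
    calc ((Nat.factorial n : ℕ) : ℝ) ^ s ≤ ((n : ℝ) ^ n) ^ s := Real.rpow_le_rpow (by positivity) h1 hs0.le
      _ = ((n : ℝ) ^ s) ^ n := by
          rw [← Real.rpow_natCast, ← Real.rpow_mul (Nat.cast_nonneg _), mul_comm,
            Real.rpow_mul (Nat.cast_nonneg _), Real.rpow_natCast]
      _ ≤ (u ^ s) ^ n := pow_le_pow_left₀ (by positivity) (Real.rpow_le_rpow (Nat.cast_nonneg _) hnu hs0.le) n
      _ = (y / C / 2 ^ s) ^ n := by rw [hus]
  have hprod : (C / y) ^ n * ((Nat.factorial n : ℕ) : ℝ) ^ s ≤ ((2 : ℝ) ^ s)⁻¹ ^ n := by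
    calc (C / y) ^ n * ((Nat.factorial n : ℕ) : ℝ) ^ s ≤ (C / y) ^ n * (y / C / 2 ^ s) ^ n :=
          mul_le_mul_of_nonneg_left hfact (by positivity)
      _ = ((2 : ℝ) ^ s)⁻¹ ^ n := by
          rw [← mul_pow]
          congr 1
          field_simp
  refine hprod.trans ?_
  have hlog : 0 < Real.log 2 := Real.log_pos (by norm_num)
  have hexp : ((2 : ℝ) ^ s)⁻¹ ^ n = Real.exp (-(n * (s * Real.log 2))) := by
    rw [Real.rpow_def_of_pos (by norm_num : (0 : ℝ) < 2), ← Real.exp_neg, ← Real.exp_nat_mul]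
    congr 1
    ring
  have hkey : s * Real.log 2 / (2 * C ^ (1 / s)) * y ^ (1 / s) = s * Real.log 2 * u := by
    rw [hu, Real.div_rpow hy.le hC.le]
    have : 0 < C ^ (1 / s) := by positivity
    field_simp
  rw [hexp, Real.rpow_def_of_pos (by norm_num : (0 : ℝ) < 2), ← Real.exp_add, neg_mul, hkey]
  apply Real.exp_le_exp.2
  nlinarith [mul_pos (sub_pos.2 hun) (mul_pos hs0 hlog)]

/-! ## 5. The discharge -/

/-- **DR 2000 Part I, App. A Lemma 11 (A.2)–(A.3) — PROVED** (discharge of the named fact `Lemma11GevreyDecay`, cell F-051):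
for `d`, `s ≥ 1`, `C > 0` there are `K, a > 0` (here `K = 2^{sd}`, `a = s log 2/(2C^{1/s})`) such that every smooth
compactly supported `ĝ` with `‖∂^n ĝ‖_∞ ≤ A₀∏_i[α_i^{n_i}C^{n_i}(n_i!)^s]` for all `n` satisfies
`|∫ e^{−ipx} ĝ(p) dp| ≤ K A₀ |supp ĝ| e^{−aΣ_i|x_i/α_i|^{1/s}}` for all `x`.  Proof = integration by parts in every coordinate
× optimisation of the orders, see the module docstring. [cite: DisertoriRivasseau2000, App. A Lemma 11 p0016:L99–132] -/
theorem Lemma11GevreyDecay_holds : Lemma11GevreyDecay := by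
  intro d s C hs hC
  have hs0 : 0 < s := by linarith
  have hlog : 0 < Real.log 2 := Real.log_pos (by norm_num)
  set a : ℝ := s * Real.log 2 / (2 * C ^ (1 / s)) with ha
  have ha0 : 0 < a := by positivity
  refine ⟨((2 : ℝ) ^ s) ^ d, a, by positivity, ha0, ?_⟩
  intro g A₀ α hg hgc hα hbound x
  classical
  -- `A₀ ≥ 0` (take `n = 0`)
  have hA0 : 0 ≤ A₀ := by
    have h0 := hbound (fun _ => 0) x
    simp only [pow_zero, Nat.factorial_zero, Nat.cast_one, Real.one_rpow, mul_one, Finset.prod_const_one] at h0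
    exact (norm_nonneg _).trans h0
  -- the orders of the printed optimisation, coordinate by coordinate (`0` where `x_i = 0`)
  have hopt : ∀ i : Fin d, ∃ m : ℕ, α i ^ m * C ^ m * ((Nat.factorial m : ℕ) : ℝ) ^ s ≤
      |x i| ^ m * ((2 : ℝ) ^ s * Real.exp (-a * |x i / α i| ^ (1 / s))) := by
    intro i
    by_cases hxi : x i = 0
    · refine ⟨0, ?_⟩
      have hz : (0 : ℝ) ^ (1 / s) = 0 := Real.zero_rpow (by positivity)
      have h2s : (1 : ℝ) ≤ 2 ^ s := Real.one_le_rpow (by norm_num) hs0.le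
      simp only [pow_zero, Nat.factorial_zero, Nat.cast_one, Real.one_rpow, mul_one, hxi, zero_div, abs_zero, hz,
        mul_zero, Real.exp_zero, one_mul]
      exact h2s
    · have hy : 0 < |x i| / α i := div_pos (abs_pos.2 hxi) (hα i)
      obtain ⟨m, hm⟩ := gevrey_opt hs hC hy
      refine ⟨m, ?_⟩
      have hxa : |x i / α i| = |x i| / α i := by rw [abs_div, abs_of_pos (hα i)]
      rw [hxa]
      rw [← ha] at hm
      have e1 : α i ^ m * C ^ m * ((Nat.factorial m : ℕ) : ℝ) ^ s =
          |x i| ^ m * ((C / (|x i| / α i)) ^ m * ((Nat.factorial m : ℕ) : ℝ) ^ s) := by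
        have hane : α i ≠ 0 := (hα i).ne'
        have hxne : |x i| ≠ 0 := abs_ne_zero.2 hxi
        rw [div_div_eq_mul_div, div_pow, mul_pow]
        field_simp
      rw [e1]
      exact mul_le_mul_of_nonneg_left hm (by positivity)
  choose N hN using hopt
  -- step (i): `∏|x_i|^{N_i} · |f(x)| ≤ A₀ |supp ĝ| ∏ α_i^{N_i} C^{N_i} (N_i!)^s`
  have hJ := integral_mixedPartial N hg hgc x
  have hL := norm_integral_mixedPartial_le N hg hgc (hbound N) x
  rw [hJ, norm_mul, norm_prod] at hL
  simp only [norm_pow, norm_mul, Complex.norm_I, one_mul, Complex.norm_real, Real.norm_eq_abs] at hL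
  -- step (ii): compare the products
  have hP : ∏ i, α i ^ N i * C ^ N i * ((Nat.factorial (N i) : ℕ) : ℝ) ^ s ≤
      (∏ i, |x i| ^ N i) * (((2 : ℝ) ^ s) ^ d * Real.exp (-a * ∑ i, |x i / α i| ^ (1 / s))) := by
    calc ∏ i, α i ^ N i * C ^ N i * ((Nat.factorial (N i) : ℕ) : ℝ) ^ s
        ≤ ∏ i, |x i| ^ N i * ((2 : ℝ) ^ s * Real.exp (-a * |x i / α i| ^ (1 / s))) :=
          Finset.prod_le_prod (fun i _ => by have := hα i; positivity) fun i _ => hN i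
      _ = (∏ i, |x i| ^ N i) * (((2 : ℝ) ^ s) ^ d * Real.exp (-a * ∑ i, |x i / α i| ^ (1 / s))) := by
          rw [Finset.prod_mul_distrib, Finset.prod_mul_distrib, Finset.prod_const, Finset.card_univ,
            Fintype.card_fin, Finset.mul_sum, Real.exp_sum]
  have hX : 0 < ∏ i, |x i| ^ N i := by
    refine Finset.prod_pos fun i _ => ?_
    by_cases hxi : x i = 0
    · -- then the chosen order is irrelevant: `|0|^N ≥ ...` forces positivity via `hN`
      have h := hN i
      rcases Nat.eq_zero_or_pos (N i) with h0 | hpos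
      · rw [h0, pow_zero]; exact one_pos
      · exfalso
        rw [hxi, abs_zero, zero_pow hpos.ne', zero_mul] at h
        have : 0 < α i ^ N i * C ^ N i * ((Nat.factorial (N i) : ℕ) : ℝ) ^ s := by
          have := hα i
          have : (0 : ℝ) < ((Nat.factorial (N i) : ℕ) : ℝ) := by exact_mod_cast Nat.factorial_pos _
          positivity
        linarith
    · exact pow_pos (abs_pos.2 hxi) _
  have hV : 0 ≤ (volume (Function.support g)).toReal := ENNReal.toReal_nonneg
  -- divide by `∏|x_i|^{N_i}`
  have hfin : (∏ i, |x i| ^ N i) * ‖∫ p, Complex.exp (-((∑ j, p j * x j : ℝ) : ℂ) * Complex.I) * g p‖ ≤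
      (∏ i, |x i| ^ N i) * (((2 : ℝ) ^ s) ^ d * A₀ * (volume (Function.support g)).toReal *
        Real.exp (-a * ∑ i, |x i / α i| ^ (1 / s))) := by
    calc (∏ i, |x i| ^ N i) * ‖∫ p, Complex.exp (-((∑ j, p j * x j : ℝ) : ℂ) * Complex.I) * g p‖
        ≤ A₀ * (∏ i, α i ^ N i * C ^ N i * ((Nat.factorial (N i) : ℕ) : ℝ) ^ s) *
            (volume (Function.support g)).toReal := hL
      _ ≤ A₀ * ((∏ i, |x i| ^ N i) * (((2 : ℝ) ^ s) ^ d * Real.exp (-a * ∑ i, |x i / α i| ^ (1 / s)))) *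
            (volume (Function.support g)).toReal :=
          mul_le_mul_of_nonneg_right (mul_le_mul_of_nonneg_left hP hA0) hV
      _ = _ := by ring
  exact le_of_mul_le_mul_left hfin hX

end Literature.MathematicalPhysics.QuantumLattice.FermiRG.DR2000

end
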